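import Summits.KontsevichZagierPeriods.KontsevichZagierPeriods.Theses.ComplexOrientations
import Summits.KontsevichZagierPeriods.KontsevichZagierPeriods.Theses.AbelContraction
import Summits.KontsevichZagierPeriods.KontsevichZagierPeriods.Theorems.AbelContractionAreasToArcs

/-!
# Crux `OrientationKernel` (stmt-KontsevichZagierPeriods-11367) — line `birth` (reshaped by lead c11,
logical position LANDED by lead c15, 2026-08-17): both open stubs are EXISTING items verbatim

Route `ComplexOrientations`, rank-0 TARGET crux `OrientationKernel` (the kernel conjecture of the KZ
calculus ENLARGED by the route's relators): for every subgroup `R ≥ KZ.relations` containing (i) the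
type-I unit-sign oval identities, (ii) the integer oval-sector identities of one compact smooth real
plane curve against a `π`-carrier and (iii) the Cauchy relators, `ker KZ.eval ⊆ R`.

Line `birth` cuts the crux along the **1-period sector** (Huber–Wüstholz's layer: representations of
dimension `≤ 1`, bounded planar integrand-`1` representations). The registrar's hardest stub
`stub_sectorReduction` ("every vanishing combination is congruent modulo the moves to an element of the
sector") is EQUIVALENT to the existing open item stmt-KontsevichZagierPeriods-14403
`AbelContraction.ReductionToDimensionOne` ("every subgroup `R ≥ KZ.relations` containing `[r] − [r']`
for all equal-valued one-dimensional `r, r'` contains `ker KZ.eval`") — LANDED as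
`ComplexOrientations.OrientationKernel.sectorReduction_iff_reductionToDimensionOne`
(`Theorems/ComplexOrientationsOrientationKernelReductionNecessity.lean`): `←` take
`R₀ := KZ.relations ⊔ S`; `→` by the landed merge `stub_sectorMerge` (p140035), the landed area
slicing `SymplecticScissors.PlanarAreas.stub_areaSlicing` and the landed SAME-DIMENSION tools of
dimension one (`Theorems/ComplexOrientationsOrientationKernelDimensionOneMerge.lean`, p146348: every
one-dimensional representation is `≡` ONE representation with domain in `(−1, 1)` — rule (1a) at the
origin, rule (2) along the rational charts `t / (1 ± t)`, glue — so any two merge by a rational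
translate, and `closure {[s] | s 1-dim}` consists of pairs `[a] − [b]` modulo the moves). The skeleton
has the two stubs

* `stub_reductionToDimensionOne` = item stmt-KontsevichZagierPeriods-14403 VERBATIM (conjecture-grade,
  GPC-strength, stated openly by route AbelContraction: "modulo the 1-period layer it is exactly as
  strong as the summit"); it is NECESSARY for this crux — LANDED:
  `ComplexOrientations.OrientationKernel.reductionToDimensionOne_of_orientationKernel :
  OrientationKernel → ReductionToDimensionOne` (an admissible `R` of stmt-14403 contains the oval
  relators of families (i)/(ii) — vanishing integer combinations of planar integrand-`1` classes,
  sliced into one-dimensional classes and merged into one equal-valued pair — and the Cauchy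
  relators of family (iii), which lie in `KZ.relations` by the closed `cauchyMove_proof`);
* `stub_planarAreas` = item stmt-KontsevichZagierPeriods-4990 VERBATIM (`PlanarAreas`, the shared
  1-period-layer crux of routes HodgeLevel / LowDimension / SymplecticScissors / AbelContraction /
  UnfoldedStokes; Huber–Wüstholz 2022 Thm 13.3 transferred into real semialgebraic move chains);

with the composition `OrientationKernel_of` (also landed in closed form as
`orientationKernel_of_reductionToDimensionOne_of_planarAreas`): given an admissible
`R ⊇ KZ.relations`, the planar kernel gives the one-dimensional kernel
(`AbelContraction.AreasToArcs.areasToArcs_proof`, landed: a 1-dimensional representation is a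
difference of two bands, rule (3) with primitive `t`), so `R` contains `[r] − [r']` for all
equal-valued one-dimensional pairs, and `stub_reductionToDimensionOne` puts `ker KZ.eval` inside `R`.
The route's three relator hypotheses on `R` are carried, not consumed (modulo the route's engines the
target IS Conjecture 1 — route docstring, support `KernelFormGlue`).

Logical position, ALL LANDED: `KZ kernel form → OrientationKernel → ReductionToDimensionOne`
(`KernelFormGlue_proof`, `reductionToDimensionOne_of_orientationKernel`);
`ReductionToDimensionOne ∧ PlanarAreas → OrientationKernel`
(`orientationKernel_of_reductionToDimensionOne_of_planarAreas`), hence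
`PlanarAreas → (OrientationKernel ↔ ReductionToDimensionOne)`; the exact cut
`OrientationKernel ↔ ReductionToDimensionOne ∧ SectorKernel`
(`orientationKernel_iff_reductionToDimensionOne_and_sectorKernel`; `SectorKernel` = the crux restricted
to the sector) and `PlanarAreas → SectorKernel` (`sectorKernel_of_boundedPlanarKernel`,
`boundedPlanarKernel_of_planarAreas`). The crux is therefore parked on stmt-14403 BY THEOREM; nothing
stub-sized remains in this line.

Disproof used: none exists for this crux (`ledger crux ls`: no `Disproof.lean`, no `Negative/`).
Degenerate data: `x = 0` is in every `R`; `k = 0`, `β = 0`, empty carriers are relations (route Sketch).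
-/

noncomputable section

open Literature.NumberTheory.Transcendental

namespace Summit.KontsevichZagierPeriods.KontsevichZagierPeriods.Cruxes.OrientationKernel.Birth

/-! ### Registered stubs -/

/-- **STUB (conjecture-grade) = item stmt-KontsevichZagierPeriods-14403 verbatim**
(`AbelContraction.ReductionToDimensionOne`, the GPC-strength layer of the input-dimension filtration):
every subgroup `R` of `KZ.FormalRep` with `KZ.relations ≤ R` that contains `[r] − [r']` for every
pair of one-dimensional representations `r, r'` of equal value contains `ker KZ.eval` — equivalently
(`R₀ := KZ.relations ⊔ ⟨differences of equal-valued 1-dimensional classes⟩`), every vanishing formal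
combination is a sum of move instances and of such differences. Equivalent to the registrar's
`stub_sectorReduction` (`sectorReduction_iff_reductionToDimensionOne`, landed c15) and NECESSARY for
the crux (`reductionToDimensionOne_of_orientationKernel`, landed c15). Why it might fail: iff some vanishing combination of
inputs of dimension `≥ 2` (`ζ(2)`, MZV, `Γ`-products, elliptic quasi-period products) is underivable
even modulo the 1-period layer — the strength barriers of the catalogue bite here, openly. Closes when
stmt-14403 closes. [KontsevichZagier2001 §1.2; HuberMullerStach2017 Ch. 13; Ayoub2015; Fresan2024] -/
theorem stub_reductionToDimensionOne :
    ∀ R : AddSubgroup KZ.FormalRep, KZ.relations ≤ R →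
      (∀ (r r' : KZ.IntegralRep 1), r.value = r'.value → KZ.of r - KZ.of r' ∈ R) →
      ∀ x : KZ.FormalRep, KZ.eval x = 0 → x ∈ R := by
  sorry

/-- **STUB (conjecture-grade) = item stmt-KontsevichZagierPeriods-4990 verbatim** (`PlanarAreas`, the
shared crux of routes LowDimension / HodgeLevel / SymplecticScissors / AbelContraction / UnfoldedStokes):
two planar representations with integrand `1` on their domains and the same area are KZ-equivalent —
curved planar Hilbert III over `ℚ̄` inside the rules; by Newton–Leibniz along `y` these areas are
exactly the real 1-periods, so this is Huber–Wüstholz's theorem (all `ℚ̄`-linear relations among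
1-periods are of motivic origin, HuberWustholz2022 Thm 13.3) TRANSFERRED into chains of real
semialgebraic moves. Why it might fail: one isogeny / correspondence / residue identity among real
1-periods with no real move chain refutes it (and the summit). Closes when stmt-4990 closes.
[HuberWustholz2022, SertozOuaknineWorrell2025, KontsevichZagier2001] -/
theorem stub_planarAreas :
    ∀ (r r' : KZ.IntegralRep 2), (∀ p ∈ r.domain, r.integrand p = 1) →
      (∀ p ∈ r'.domain, r'.integrand p = 1) → r.value = r'.value → KZ.Equivalent r r' := by
  sorry

/-! ### Composition (no `sorry` below this line) -/

/-- **Composition**: the crux `OrientationKernel` BY NAME from the two registered stubs, consumed by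
name. Given an admissible `R ⊇ KZ.relations` and `x` with `KZ.eval x = 0`: the planar kernel
`stub_planarAreas` gives the one-dimensional kernel through the landed transfer
`AbelContraction.AreasToArcs.areasToArcs_proof` (a one-dimensional representation is a difference of
two planar bands by rule (3) with primitive `t`), so `[r] − [r'] ∈ KZ.relations ≤ R` for all
equal-valued one-dimensional `r, r'`; then `stub_reductionToDimensionOne` at `R` gives `x ∈ R`. The
three relator hypotheses on `R` are carried, not consumed. `#print axioms` = whitelist ∪ {sorryAx via
the two stubs only}. -/
theorem OrientationKernel_of :
    Summit.KontsevichZagierPeriods.KontsevichZagierPeriods.Theses.ComplexOrientations.OrientationKernel := by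
  -- the two stub statements, by name
  have hred := stub_reductionToDimensionOne
  have hplanar := stub_planarAreas
  -- the one-dimensional kernel from the planar kernel (landed transfer, rule (3) bands)
  have hone : ∀ (r r' : KZ.IntegralRep 1), r.value = r'.value → KZ.Equivalent r r' :=
    Summit.KontsevichZagierPeriods.AbelContraction.AreasToArcs.areasToArcs_proof hplanar
  -- the composition proper
  intro R hRel _hI _hII _hIII x hx
  exact hred R hRel (fun r r' hv => hRel (hone r r' hv)) x hx

end Summit.KontsevichZagierPeriods.KontsevichZagierPeriods.Cruxes.OrientationKernel.Birth

end
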